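import Summits.BirchSwinnertonDyer.BirchSwinnertonDyer.Theorems.AdditiveBranchIMCGordTwoRankZeroCompanion
import Summits.BirchSwinnertonDyer.Rank1Residual.Additive.GordCycLeadingTermSemistableTwist
import Summits.BirchSwinnertonDyer.Rank1Residual.Additive.N10LowerHalfStatements
import Summits.BirchSwinnertonDyer.BirchSwinnertonDyer.Theses.AdditiveBranchIMC
import HarnessLib

/-!
# Crux `GordTwoRankZeroOffCaseOne` (item 19357): the SELMER-COMPANION / VISIBILITY DOORS on cell
# (G-ord, `e = 2`) ∩ `r_an = 0` — `ord_p #Ш(E)_an ≤ ord_p #Ш(E)` (every odd `p`) and `BSD(E,p)` (`p ≥ 5`,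
# `ρ̄` onto) from a `p`-congruent partner and ONE named rational point, the additive place `p` FREE by
# Mazur–Rubin 2015 Thm. 3.1 for the twist `χ_{p*}`; the crux BY NAME from row data

Cell `bsd-addord`, seat `bsd-addord-k1-c2` (D-0074 row B1), gen 4; sibling of
`AdditiveBranchIMCGordTwoRankZeroCompanion.lean` (the local dispatch and the visible element of `Ш[p]`,
same gen), which see for the mathematics and the honest framing. HONEST FRAMING: nothing here proves
the Birch–Swinnerton-Dyer conjecture or the crux; THEOREMS ONLY (no definition, no named fact, no
`sorry`); every published input is an explicit named-fact binder; every per-pair input is a displayed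
binder decided OUTSIDE this file; nothing is booked by this file.

## What

* §3 the DOORS on cell (G-ord, `e = 2`) ∩ `r_an = 0` (the cell supplies `W`'s own twist model,
  `TypeGOrd.exists_goodOrd_pStar_twist_model`): `MissingLowerBoundAt W p` for EVERY odd `p` (`p = 3`
  included) from Cassels–Tate (`hCT`), GZK (`hGZK`), Mazur–Rubin 2015 twisted (`hMRt`) [+ `hU hU2 hF44`
  for the kinds (ii)–(iv)], `E[p]` irreducible (so `p ∤ #E(ℚ)`), the datum `#Ш_an = q` with `ord_p q ≤ 2`,
  and the per-pair data — partner `W'` with an explicit twist model (`V'` good at `p`) or in the same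
  cell, `θ : W'[p] ⥲ W[p]`, places `S`, witness `P ∈ W'(ℚ) ∖ pW'(ℚ)` with its local options; and
  `BSD(E,p)` at `p ≥ 5` on the surjective rows (+ the Kato upper half on the semistable-twist locus,
  `Addv.missingUpperBoundAt_rankZero_of_semistableTwist_of_surj`: `hK hDel98 hPal hmod hmodD`) — the
  BOOKING door; and the TWIST-MODEL forms of both (`…_of_twistModels_witness`: `W`'s own model `C • V^{(p*)}`
  displayed instead of the cell binder — the shape a per-pair kernel record instantiates). NO engine value,
  NO λ / budget / rank binder, NO Kato–EPW–GV–Delbourgo on the lower side.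
* §4 the crux BY NAME from row data (records exactly what a per-pair certificate buys; the crux stays OPEN).

Reach (kit j257320, EVIDENCE on item 19357, this gen): of the cell's rank-`0` rows with
`ord_p #Ш_an = 2` and a deep-screened rank-`≥ 2` congruent partner of the same kind, ALL 46 at `p = 5`,
ALL 6 at `p = 7` and 309 of 317 at `p = 3` have every bad place free ((i)/(ii)/(iii)/(iv)/(vi)) or
absorbed by a witness (a) — among them the 15 rows that engine A (gen 3) left OPEN because the
partner's `λ` exceeds its rank (`2900d1 ~ 2900c1`: places `2` (i), `5` (vi), `29` (iii)).

References: Mazur–Rubin 2015 Thm. 3.1, §6 Case 5 [MazurRubin2015SelmerCompanions]; Cremona–Mazur 2000 §3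
[CremonaMazur2000]; Agashe–Stein 2002 Lemma 3.6 [AgasheStein2002]; Fisher 2016 Thm. 4.4
[Fisher2016Visualizing7]; Silverman ATAEC V.3.1/V.5.3 [SilvermanATAEC1994]; Silverman AEC X.4.14
[SilvermanAEC2009]; Kato 2004 Thm. 17.4 [Kato2004Asterisque]; Delbourgo 1998 Prop. 4 [Delbourgo1998];
Pal 2012 Thm. 3.2 [Pal2012]; Miller 2011 Def. 1.1 [Miller2011LMS]; Mazur 1977 III.§5 [Mazur1977].
-/

set_option autoImplicit false

noncomputable section

open scoped Classical

open WeierstrassCurve Literature.NumberTheory.EllipticCurves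
  Literature.NumberTheory.EllipticCurves.Rank1Residual
  Literature.NumberTheory.EllipticCurves.Rank1Residual.Typed
  Literature.NumberTheory.EllipticCurves.Wuthrich2014
  Literature.NumberTheory.EllipticCurves.Fisher2016
  Literature.NumberTheory.EllipticCurves.MazurRubin2015
  Literature.NumberTheory.GaloisRepresentations
  Summit.BirchSwinnertonDyer.Rank1Residual.GaloisImage
open NumberField IsDedekindDomain Rat.HeightOneSpectrum Field
  Literature.NumberTheory.EllipticCurves.ModularForms

set_option linter.dupNamespace false

namespace Summit.BirchSwinnertonDyer.BirchSwinnertonDyer.Theorems.AdditiveBranchIMCGordTwoRankZeroCompanion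

open Summit.BirchSwinnertonDyer.Rank1Residual
open Summit.BirchSwinnertonDyer.Rank1Residual.Additive

/-! ## §3 The doors on cell (G-ord, `e = 2`) ∩ `r_an = 0` -/

section Doors

variable {W : WeierstrassCurve ℚ} [W.IsElliptic] [W.IsGloballyMinimal] {p : ℕ} [hp : Fact p.Prime]

/-- **The LOWER half by visibility, cell (G-ord, `e = 2`) ∩ {`E[p]` irreducible} ∩ `r_an = 0`, EVERY odd
`p` (`p = 3` included), lean form.** Published inputs (binders): Cassels–Tate (`hCT`), GZK (`hGZK`),
Mazur–Rubin 2015 twisted (`hMRt`). Per-pair data (binders, decidable outside this file): the partner `W'`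
with its twist model `C' • V'^{(p*)} = W'`, `V'` GOOD at `p` (ordinary or supersingular; e.g. `W'` in the
same cell), a `Γ_ℚ`-isomorphism `θ : W'[p] ⥲ W[p]`, the finite set `S` of places (both curves good and
`w ∤ p` outside), ONE point `P ∈ W'(ℚ) ∖ pW'(ℚ)` and, at each `w ∈ S`: (a) a `p`-th root of `P` in
`W'(ℚ_w)`, or (i) `w ∤ p` with `W'(ℚ_w)[p] = 0`, or (vi) `w ∣ p`; and the datum `#Ш(E)_an = q` with
`ord_p q ≤ 2`. The cell supplies `W`'s own twist model `C • V^{(p*)} = W`, `V` good ordinary at `p`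
(`TypeGOrd.exists_goodOrd_pStar_twist_model`). Chain: §2 (`E(ℚ)` finite by GZK, of order prime to `p`
by irreducibility) ⟹ `p ∣ #Ш(E)` ⟹ Cassels–Tate squareness (`missingLowerBoundAt_of_casselsTate_of_pow_dvd`)
⟹ `ord_p #Ш_an ≤ ord_p #Ш`. NO Kato / EPW / GV / Delbourgo / Pal binder, NO engine value, NO rank binder.
Per pair; NOT a class theorem; the crux stays OPEN. [cite: MazurRubin2015SelmerCompanions, Thm. 3.1 and §6 Case 5]
[cite: CremonaMazur2000, §3 and Table 1] [cite: AgasheStein2002, Lemma 3.6] [cite: SilvermanAEC2009, Thm. X.4.14]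
[cite: Mazur1977, Ch. III §5] -/
theorem missingLowerBoundAt_rankZero_irr_of_companionWitness
    (hCT : exists_casselsTate_pairing (K := ℚ)) (hGZK : rank_eq_analyticRank_of_analyticRank_le_one)
    (hMRt : selmerLocalKer_iff_of_twist_of_goodReduction_above)
    (hc : N10.CellGordTwo W p) (hirr : Irr W p) (hr : W.analyticRank = 0)
    {q : ℚ} (hq : shaAn W = (q : ℂ)) (hv : padicValRat p q ≤ 2)
    (W' : WeierstrassCurve ℚ) [W'.IsElliptic] (V' : WeierstrassCurve ℚ) [V'.IsElliptic]
    (C' : VariableChange ℚ) (hWV' : C' • V'.quadraticTwist ((-1 : ℚ) ^ (p / 2) * p) = W')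
    (hV' : V'.HasGoodReductionAtPrime p)
    (θ : geomTorsion W' (p : ℤ) ≃+ geomTorsion W (p : ℤ))
    (hθ : ∀ (σ : absoluteGaloisGroup ℚ) (P : geomTorsion W' (p : ℤ)), θ (σ • P) = σ • θ P)
    (S : Finset (HeightOneSpectrum (𝓞 ℚ)))
    (hS : ∀ w : HeightOneSpectrum (𝓞 ℚ), w ∉ S →
      W.HasGoodReductionAt w ∧ W'.HasGoodReductionAt w ∧ (p : 𝓞 ℚ) ∉ w.asIdeal)
    (P : W'.toAffine.Point)
    (hP : P ∉ (zsmulAddGroupHom (p : ℤ) : W'.toAffine.Point →+ W'.toAffine.Point).range)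
    (hplaces : ∀ w ∈ S,
      (∃ Q : (W'.baseChange (w.adicCompletion ℚ)).toAffine.Point,
        p • Q = WeierstrassCurve.Affine.Point.baseChange (W' := W') ℚ (w.adicCompletion ℚ) P) ∨
      ((p : 𝓞 ℚ) ∉ w.asIdeal ∧ Nat.card (nsmulAddMonoidHom p :
          (W'.baseChange (w.adicCompletion ℚ)).toAffine.Point →+ _).ker = 1) ∨
      ((p : 𝓞 ℚ) ∈ w.asIdeal)) :
    MissingLowerBoundAt W p := by
  obtain ⟨hp2, hadd, hG, he⟩ := hc
  obtain ⟨V, _, _, C, hVord, hWV⟩ := TypeGOrd.exists_goodOrd_pStar_twist_model W p hp2 hG hadd he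
  haveI hfin : Finite W.toAffine.Point := finite_point_of_analyticRank_eq_zero W hGZK hr
  have hcop : (Nat.card W.toAffine.Point).Coprime p := coprime_natCard_point_of_irr W p hirr
  have hex : ∃ c : W.sha, c ≠ 0 ∧ p • c = 0 :=
    exists_sha_ne_zero_of_congr_of_witness_twist hMRt hp2 θ hθ V V' C C' (pStar_ne_zero p) hWV hWV'
      hVord.1 hV' S hS hfin hcop P hP hplaces
  have hfinSha : W.ShaFinite := (hGZK W (by rw [hr]; norm_num)).2
  exact missingLowerBoundAt_of_casselsTate_of_pow_dvd W p hCT hfinSha hq (k := 1) (by simpa using hv)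
    (by simpa using dvd_shaOrder_of_exists_torsion W p hex)

/-- **The LOWER half by visibility, cell (G-ord, `e = 2`) ∩ {`E[p]` irreducible} ∩ `r_an = 0`, every odd
`p`, six-option form** (kinds (ii)/(iii)/(iv) at the multiplicative places available: Tate uniformisation
`hU`/`hU2`, Fisher 2016 Thm. 4.4 `hF44`). As `…_of_companionWitness` otherwise.
[cite: MazurRubin2015SelmerCompanions, Thm. 3.1 and §6 Case 5] [cite: Fisher2016Visualizing7, Thm. 4.4 (p. 106)]
[cite: SilvermanATAEC1994, Ch. V Thm. 3.1, Thm. 5.3, Cor. 5.4] [cite: CremonaMazur2000, §3] [cite: SilvermanAEC2009, Thm. X.4.14] -/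
theorem missingLowerBoundAt_rankZero_irr_of_companionWitness₆
    (hCT : exists_casselsTate_pairing (K := ℚ)) (hGZK : rank_eq_analyticRank_of_analyticRank_le_one)
    (hU : Silverman1994_thmV53_tateUniformisation.{0})
    (hU2 : Silverman1994_thmV53_corV54_tateUniformisation.{0})
    (hF44 : thm44_selmerLocalKer_iff_of_nonsplit_good)
    (hMRt : selmerLocalKer_iff_of_twist_of_goodReduction_above)
    (hc : N10.CellGordTwo W p) (hirr : Irr W p) (hr : W.analyticRank = 0)
    {q : ℚ} (hq : shaAn W = (q : ℂ)) (hv : padicValRat p q ≤ 2)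
    (W' : WeierstrassCurve ℚ) [W'.IsElliptic] (V' : WeierstrassCurve ℚ) [V'.IsElliptic]
    (C' : VariableChange ℚ) (hWV' : C' • V'.quadraticTwist ((-1 : ℚ) ^ (p / 2) * p) = W')
    (hV' : V'.HasGoodReductionAtPrime p)
    (θ : geomTorsion W' (p : ℤ) ≃+ geomTorsion W (p : ℤ))
    (hθ : ∀ (σ : absoluteGaloisGroup ℚ) (P : geomTorsion W' (p : ℤ)), θ (σ • P) = σ • θ P)
    (S : Finset (HeightOneSpectrum (𝓞 ℚ)))
    (hS : ∀ w : HeightOneSpectrum (𝓞 ℚ), w ∉ S →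
      W.HasGoodReductionAt w ∧ W'.HasGoodReductionAt w ∧ (p : 𝓞 ℚ) ∉ w.asIdeal)
    (P : W'.toAffine.Point)
    (hP : P ∉ (zsmulAddGroupHom (p : ℤ) : W'.toAffine.Point →+ W'.toAffine.Point).range)
    (hplaces : ∀ w ∈ S,
      (∃ Q : (W'.baseChange (w.adicCompletion ℚ)).toAffine.Point,
        p • Q = WeierstrassCurve.Affine.Point.baseChange (W' := W') ℚ (w.adicCompletion ℚ) P) ∨
      ((p : 𝓞 ℚ) ∉ w.asIdeal ∧ Nat.card (nsmulAddMonoidHom p :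
          (W'.baseChange (w.adicCompletion ℚ)).toAffine.Point →+ _).ker = 1) ∨
      (W.HasSplitMultiplicativeReductionAt w ∧ W'.HasSplitMultiplicativeReductionAt w ∧
        Nat.card (nsmulAddMonoidHom p :
          (W.baseChange (w.adicCompletion ℚ)).toAffine.Point →+ _).ker ≤ p) ∨
      (W.HasMultiplicativeReductionAt w ∧ W'.HasMultiplicativeReductionAt w ∧
        (∃ r : w.adicCompletion ℚ, algebraMap ℚ (w.adicCompletion ℚ) (-(W.c₄ / W.c₆)) =
          r ^ 2 * algebraMap ℚ (w.adicCompletion ℚ) (-(W'.c₄ / W'.c₆))) ∧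
        (∀ ζ : w.adicCompletion ℚ, ζ ^ p = 1 → ζ = 1)) ∨
      ((W.HasMultiplicativeReductionAt w ∧ ¬ W.HasSplitMultiplicativeReductionAt w ∧
          W'.HasGoodReductionAt w) ∨
        (W.HasGoodReductionAt w ∧ W'.HasMultiplicativeReductionAt w ∧
          ¬ W'.HasSplitMultiplicativeReductionAt w)) ∨
      ((p : 𝓞 ℚ) ∈ w.asIdeal)) :
    MissingLowerBoundAt W p := by
  obtain ⟨hp2, hadd, hG, he⟩ := hc
  obtain ⟨V, _, _, C, hVord, hWV⟩ := TypeGOrd.exists_goodOrd_pStar_twist_model W p hp2 hG hadd he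
  haveI hfin : Finite W.toAffine.Point := finite_point_of_analyticRank_eq_zero W hGZK hr
  have hcop : (Nat.card W.toAffine.Point).Coprime p := coprime_natCard_point_of_irr W p hirr
  have hex : ∃ c : W.sha, c ≠ 0 ∧ p • c = 0 :=
    exists_sha_ne_zero_of_congr_of_witness_twist₆ hU hU2 hF44 hMRt hp2 θ hθ V V' C C' (pStar_ne_zero p)
      hWV hWV' hVord.1 hV' S hS hfin hcop P hP hplaces
  have hfinSha : W.ShaFinite := (hGZK W (by rw [hr]; norm_num)).2
  exact missingLowerBoundAt_of_casselsTate_of_pow_dvd W p hCT hfinSha hq (k := 1) (by simpa using hv)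
    (by simpa using dvd_shaOrder_of_exists_torsion W p hex)

/-- **The LOWER half by visibility with the partner in the SAME cell** (G-ord, `e = 2`): the partner's
twist model is supplied by the cell (`TypeGOrd.exists_goodOrd_pStar_twist_model` for `W'`), so the
per-pair data are exactly `θ`, `S`, the witness `P` with its local options (a)/(i)/(vi), and `#Ш_an`.
Lean form; every odd `p`. [cite: MazurRubin2015SelmerCompanions, Thm. 3.1 and §6 Case 5]
[cite: CremonaMazur2000, §3 and Table 1] [cite: SilvermanAEC2009, Thm. X.4.14] -/
theorem missingLowerBoundAt_rankZero_irr_of_cellPartner_witness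
    (hCT : exists_casselsTate_pairing (K := ℚ)) (hGZK : rank_eq_analyticRank_of_analyticRank_le_one)
    (hMRt : selmerLocalKer_iff_of_twist_of_goodReduction_above)
    (hc : N10.CellGordTwo W p) (hirr : Irr W p) (hr : W.analyticRank = 0)
    {q : ℚ} (hq : shaAn W = (q : ℂ)) (hv : padicValRat p q ≤ 2)
    (W' : WeierstrassCurve ℚ) [W'.IsElliptic] [W'.IsGloballyMinimal] (hc' : N10.CellGordTwo W' p)
    (θ : geomTorsion W' (p : ℤ) ≃+ geomTorsion W (p : ℤ))
    (hθ : ∀ (σ : absoluteGaloisGroup ℚ) (P : geomTorsion W' (p : ℤ)), θ (σ • P) = σ • θ P)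
    (S : Finset (HeightOneSpectrum (𝓞 ℚ)))
    (hS : ∀ w : HeightOneSpectrum (𝓞 ℚ), w ∉ S →
      W.HasGoodReductionAt w ∧ W'.HasGoodReductionAt w ∧ (p : 𝓞 ℚ) ∉ w.asIdeal)
    (P : W'.toAffine.Point)
    (hP : P ∉ (zsmulAddGroupHom (p : ℤ) : W'.toAffine.Point →+ W'.toAffine.Point).range)
    (hplaces : ∀ w ∈ S,
      (∃ Q : (W'.baseChange (w.adicCompletion ℚ)).toAffine.Point,
        p • Q = WeierstrassCurve.Affine.Point.baseChange (W' := W') ℚ (w.adicCompletion ℚ) P) ∨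
      ((p : 𝓞 ℚ) ∉ w.asIdeal ∧ Nat.card (nsmulAddMonoidHom p :
          (W'.baseChange (w.adicCompletion ℚ)).toAffine.Point →+ _).ker = 1) ∨
      ((p : 𝓞 ℚ) ∈ w.asIdeal)) :
    MissingLowerBoundAt W p := by
  obtain ⟨hp2, hadd', hG', he'⟩ := hc'
  obtain ⟨V', _, _, C', hV'ord, hWV'⟩ := TypeGOrd.exists_goodOrd_pStar_twist_model W' p hp2 hG' hadd' he'
  exact missingLowerBoundAt_rankZero_irr_of_companionWitness hCT hGZK hMRt hc hirr hr hq hv W' V' C' hWV'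
    hV'ord.1 θ hθ S hS P hP hplaces

/-- **`BSD(E,p)` by visibility, `p ≥ 5`: cell (G-ord, `e = 2`) ∩ {`ρ̄_{E,p}` onto} ∩ `r_an = 0` — the BOOKING
door.** The lower half `missingLowerBoundAt_rankZero_irr_of_companionWitness` (irreducible ⟸ onto, Serre)
+ the Kato UPPER half on the semistable-twist locus (`Addv.missingUpperBoundAt_rankZero_of_semistableTwist_of_surj`:
Kato's half-eigenspace divisibility `hK`, Delbourgo 1998 Prop. 4 weak form `hDel98`, Pal `hPal`, GZK,
modularity `hmod`/`hmodD`; the good-ordinary twist model exists on the cell) + Miller's bookkeeping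
(`missingPPartAt_of_lower_of_upper`, `bsdp_of_missingPPartAt`). Per pair modulo the named facts
`hCT hGZK hMRt hK hDel98 hPal hmod hmodD` and the displayed per-pair data; NO engine value, NO rank / λ /
budget binder; books nothing by itself. [cite: MazurRubin2015SelmerCompanions, Thm. 3.1 and §6 Case 5]
[cite: CremonaMazur2000, §3 and Table 1] [cite: Kato2004Asterisque, Thm. 17.4 (3) (p. 273)]
[cite: Delbourgo1998, Prop. 4 (p. 144)] [cite: Pal2012, Thm. 3.2] [cite: SilvermanAEC2009, Thm. X.4.14] [cite: Miller2011LMS, Def. 1.1] -/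
theorem bsdp_rankZero_surj_of_companionWitness
    (hCT : exists_casselsTate_pairing (K := ℚ)) (hGZK : rank_eq_analyticRank_of_analyticRank_le_one)
    (hMRt : selmerLocalKer_iff_of_twist_of_goodReduction_above)
    (hK : Wuthrich2014.kato_halfEigenCharIdeal_dvd_cyclotomicPrime_of_surjective)
    (hDel98 : Delbourgo1998.prop4_rankZero_pow_dvd_constantCoeff)
    (hPal : Pal2012.thm32_sqrt_mul_realPeriodRat_twist_eq_of_prime_one_mod_four)
    (hmod : hasEntireLFunction_rat) (hmodD : nonempty_modularParametrizationData)
    (hc : N10.CellGordTwo W p) (hsurj : Surj W p) (hp5 : 5 ≤ p) (hr : W.analyticRank = 0)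
    {q : ℚ} (hq : shaAn W = (q : ℂ)) (hv : padicValRat p q ≤ 2)
    (W' : WeierstrassCurve ℚ) [W'.IsElliptic] (V' : WeierstrassCurve ℚ) [V'.IsElliptic]
    (C' : VariableChange ℚ) (hWV' : C' • V'.quadraticTwist ((-1 : ℚ) ^ (p / 2) * p) = W')
    (hV' : V'.HasGoodReductionAtPrime p)
    (θ : geomTorsion W' (p : ℤ) ≃+ geomTorsion W (p : ℤ))
    (hθ : ∀ (σ : absoluteGaloisGroup ℚ) (P : geomTorsion W' (p : ℤ)), θ (σ • P) = σ • θ P)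
    (S : Finset (HeightOneSpectrum (𝓞 ℚ)))
    (hS : ∀ w : HeightOneSpectrum (𝓞 ℚ), w ∉ S →
      W.HasGoodReductionAt w ∧ W'.HasGoodReductionAt w ∧ (p : 𝓞 ℚ) ∉ w.asIdeal)
    (P : W'.toAffine.Point)
    (hP : P ∉ (zsmulAddGroupHom (p : ℤ) : W'.toAffine.Point →+ W'.toAffine.Point).range)
    (hplaces : ∀ w ∈ S,
      (∃ Q : (W'.baseChange (w.adicCompletion ℚ)).toAffine.Point,
        p • Q = WeierstrassCurve.Affine.Point.baseChange (W' := W') ℚ (w.adicCompletion ℚ) P) ∨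
      ((p : 𝓞 ℚ) ∉ w.asIdeal ∧ Nat.card (nsmulAddMonoidHom p :
          (W'.baseChange (w.adicCompletion ℚ)).toAffine.Point →+ _).ker = 1) ∨
      ((p : 𝓞 ℚ) ∈ w.asIdeal)) :
    BSDp W p := by
  have hirr : Irr W p := hasIrreducibleModPGaloisRep_of_hasSurjectiveModNGaloisRep W p hsurj
  have hlow : MissingLowerBoundAt W p :=
    missingLowerBoundAt_rankZero_irr_of_companionWitness hCT hGZK hMRt hc hirr hr hq hv W' V' C' hWV' hV'
      θ hθ S hS P hP hplaces
  obtain ⟨hp2, hadd, hG, he⟩ := hc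
  obtain ⟨V, _, _, C, hVord, hWV⟩ := TypeGOrd.exists_goodOrd_pStar_twist_model W p hp2 hG hadd he
  exact bsdp_of_missingPPartAt W p hGZK (by omega)
    (missingPPartAt_of_lower_of_upper W p hlow
      (Addv.missingUpperBoundAt_rankZero_of_semistableTwist_of_surj hK hDel98 hPal hGZK hmod hmodD hp5
        hadd V C hWV (Or.inl hVord) hsurj hr))

omit [W.IsGloballyMinimal] in
/-- **The LOWER half by visibility, TWIST-MODEL form (no cell binder; the shape a per-pair record instantiates).**
`W = C • V^{(p*)}` with `V` GOOD at `p` (any odd `p`; on cell (G-ord, `e = 2`) this is the cell's own twist model,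
but a good SUPERSINGULAR `V` is allowed too), `E[p]` irreducible, `r_an = 0`, `#Ш_an = q` with `ord_p q ≤ 2`; the
partner `W' = C' • V'^{(p*)}` with `V'` good at `p`; `θ`, `S`, the witness `P` with local options (a)/(i)/(vi).
Then `ord_p #Ш(E)_an ≤ ord_p #Ш(E)`. Named facts: Cassels–Tate, GZK, Mazur–Rubin 2015 (twisted).
[cite: MazurRubin2015SelmerCompanions, Thm. 3.1 and §6 Case 5] [cite: CremonaMazur2000, §3 and Table 1]
[cite: SilvermanAEC2009, Thm. X.4.14] [cite: Mazur1977, Ch. III §5] -/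
theorem missingLowerBoundAt_rankZero_irr_of_twistModels_witness
    (hCT : exists_casselsTate_pairing (K := ℚ)) (hGZK : rank_eq_analyticRank_of_analyticRank_le_one)
    (hMRt : selmerLocalKer_iff_of_twist_of_goodReduction_above)
    (hp2 : p ≠ 2) (hirr : Irr W p) (hr : W.analyticRank = 0)
    {q : ℚ} (hq : shaAn W = (q : ℂ)) (hv : padicValRat p q ≤ 2)
    (V : WeierstrassCurve ℚ) [V.IsElliptic] (C : VariableChange ℚ)
    (hWV : C • V.quadraticTwist ((-1 : ℚ) ^ (p / 2) * p) = W) (hV : V.HasGoodReductionAtPrime p)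
    (W' : WeierstrassCurve ℚ) [W'.IsElliptic] (V' : WeierstrassCurve ℚ) [V'.IsElliptic]
    (C' : VariableChange ℚ) (hWV' : C' • V'.quadraticTwist ((-1 : ℚ) ^ (p / 2) * p) = W')
    (hV' : V'.HasGoodReductionAtPrime p)
    (θ : geomTorsion W' (p : ℤ) ≃+ geomTorsion W (p : ℤ))
    (hθ : ∀ (σ : absoluteGaloisGroup ℚ) (P : geomTorsion W' (p : ℤ)), θ (σ • P) = σ • θ P)
    (S : Finset (HeightOneSpectrum (𝓞 ℚ)))
    (hS : ∀ w : HeightOneSpectrum (𝓞 ℚ), w ∉ S →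
      W.HasGoodReductionAt w ∧ W'.HasGoodReductionAt w ∧ (p : 𝓞 ℚ) ∉ w.asIdeal)
    (P : W'.toAffine.Point)
    (hP : P ∉ (zsmulAddGroupHom (p : ℤ) : W'.toAffine.Point →+ W'.toAffine.Point).range)
    (hplaces : ∀ w ∈ S,
      (∃ Q : (W'.baseChange (w.adicCompletion ℚ)).toAffine.Point,
        p • Q = WeierstrassCurve.Affine.Point.baseChange (W' := W') ℚ (w.adicCompletion ℚ) P) ∨
      ((p : 𝓞 ℚ) ∉ w.asIdeal ∧ Nat.card (nsmulAddMonoidHom p :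
          (W'.baseChange (w.adicCompletion ℚ)).toAffine.Point →+ _).ker = 1) ∨
      ((p : 𝓞 ℚ) ∈ w.asIdeal)) :
    MissingLowerBoundAt W p := by
  haveI hfin : Finite W.toAffine.Point := finite_point_of_analyticRank_eq_zero W hGZK hr
  have hcop : (Nat.card W.toAffine.Point).Coprime p := coprime_natCard_point_of_irr W p hirr
  have hex : ∃ c : W.sha, c ≠ 0 ∧ p • c = 0 :=
    exists_sha_ne_zero_of_congr_of_witness_twist hMRt hp2 θ hθ V V' C C' (pStar_ne_zero p) hWV hWV'
      hV hV' S hS hfin hcop P hP hplaces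
  have hfinSha : W.ShaFinite := (hGZK W (by rw [hr]; norm_num)).2
  exact missingLowerBoundAt_of_casselsTate_of_pow_dvd W p hCT hfinSha hq (k := 1) (by simpa using hv)
    (by simpa using dvd_shaOrder_of_exists_torsion W p hex)

/-- **`BSD(E,p)` by visibility, TWIST-MODEL form, `p ≥ 5`** (the booking shape a per-pair record instantiates):
`E = W` additive at `p` (`Addv W p`) with a globally minimal good ORDINARY twist model `C • V^{(p*)} = W`
(`GoodOrd V p`), `ρ̄_{E,p}` onto, `r_an = 0`, `#Ш_an = q` with `ord_p q ≤ 2`, and the companion data of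
`missingLowerBoundAt_rankZero_irr_of_twistModels_witness`; the UPPER half is Kato's on the semistable-twist locus
(`Addv.missingUpperBoundAt_rankZero_of_semistableTwist_of_surj`). Per pair modulo `hCT hGZK hMRt hK hDel98 hPal hmod
hmodD`; books nothing by itself. [cite: MazurRubin2015SelmerCompanions, Thm. 3.1 and §6 Case 5]
[cite: CremonaMazur2000, §3 and Table 1] [cite: Kato2004Asterisque, Thm. 17.4 (3) (p. 273)]
[cite: Delbourgo1998, Prop. 4 (p. 144)] [cite: Pal2012, Thm. 3.2] [cite: Miller2011LMS, Def. 1.1] -/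
theorem bsdp_rankZero_surj_of_twistModels_witness
    (hCT : exists_casselsTate_pairing (K := ℚ)) (hGZK : rank_eq_analyticRank_of_analyticRank_le_one)
    (hMRt : selmerLocalKer_iff_of_twist_of_goodReduction_above)
    (hK : Wuthrich2014.kato_halfEigenCharIdeal_dvd_cyclotomicPrime_of_surjective)
    (hDel98 : Delbourgo1998.prop4_rankZero_pow_dvd_constantCoeff)
    (hPal : Pal2012.thm32_sqrt_mul_realPeriodRat_twist_eq_of_prime_one_mod_four)
    (hmod : hasEntireLFunction_rat) (hmodD : nonempty_modularParametrizationData)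
    (hadd : Addv W p) (hsurj : Surj W p) (hp5 : 5 ≤ p) (hr : W.analyticRank = 0)
    {q : ℚ} (hq : shaAn W = (q : ℂ)) (hv : padicValRat p q ≤ 2)
    (V : WeierstrassCurve ℚ) [V.IsElliptic] [V.IsGloballyMinimal] (C : VariableChange ℚ)
    (hWV : C • V.quadraticTwist ((-1 : ℚ) ^ (p / 2) * p) = W) (hVord : GoodOrd V p)
    (W' : WeierstrassCurve ℚ) [W'.IsElliptic] (V' : WeierstrassCurve ℚ) [V'.IsElliptic]
    (C' : VariableChange ℚ) (hWV' : C' • V'.quadraticTwist ((-1 : ℚ) ^ (p / 2) * p) = W')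
    (hV' : V'.HasGoodReductionAtPrime p)
    (θ : geomTorsion W' (p : ℤ) ≃+ geomTorsion W (p : ℤ))
    (hθ : ∀ (σ : absoluteGaloisGroup ℚ) (P : geomTorsion W' (p : ℤ)), θ (σ • P) = σ • θ P)
    (S : Finset (HeightOneSpectrum (𝓞 ℚ)))
    (hS : ∀ w : HeightOneSpectrum (𝓞 ℚ), w ∉ S →
      W.HasGoodReductionAt w ∧ W'.HasGoodReductionAt w ∧ (p : 𝓞 ℚ) ∉ w.asIdeal)
    (P : W'.toAffine.Point)
    (hP : P ∉ (zsmulAddGroupHom (p : ℤ) : W'.toAffine.Point →+ W'.toAffine.Point).range)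
    (hplaces : ∀ w ∈ S,
      (∃ Q : (W'.baseChange (w.adicCompletion ℚ)).toAffine.Point,
        p • Q = WeierstrassCurve.Affine.Point.baseChange (W' := W') ℚ (w.adicCompletion ℚ) P) ∨
      ((p : 𝓞 ℚ) ∉ w.asIdeal ∧ Nat.card (nsmulAddMonoidHom p :
          (W'.baseChange (w.adicCompletion ℚ)).toAffine.Point →+ _).ker = 1) ∨
      ((p : 𝓞 ℚ) ∈ w.asIdeal)) :
    BSDp W p := by
  have hp2 : p ≠ 2 := by omega
  have hirr : Irr W p := hasIrreducibleModPGaloisRep_of_hasSurjectiveModNGaloisRep W p hsurj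
  have hlow : MissingLowerBoundAt W p :=
    missingLowerBoundAt_rankZero_irr_of_twistModels_witness hCT hGZK hMRt hp2 hirr hr hq hv V C hWV hVord.1 W'
      V' C' hWV' hV' θ hθ S hS P hP hplaces
  exact bsdp_of_missingPPartAt W p hGZK (by omega)
    (missingPPartAt_of_lower_of_upper W p hlow
      (Addv.missingUpperBoundAt_rankZero_of_semistableTwist_of_surj hK hDel98 hPal hGZK hmod hmodD hp5
        hadd V C hWV (Or.inl hVord) hsurj hr))

end Doors

/-! ## §4 The crux BY NAME from row data (records reach; the crux stays OPEN) -/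

section Crux

open Summit.BirchSwinnertonDyer.BirchSwinnertonDyer.Theses.AdditiveBranchIMC

/-- **Crux `GordTwoRankZeroOffCaseOne` (item 19357) BY NAME from per-row companion data** — what this door
would have to be fed to close the crux: Cassels–Tate, GZK, Mazur–Rubin 2015 (twisted) and, for EVERY
off-Case-1 rank-`0` pair of the cell, EITHER the lower half itself (rows with no partner in range, the
reducible rows with a rational `p`-isogeny budget, …) OR [`E[p]` irreducible, the datum `#Ш_an = q` with
`ord_p q ≤ 2`, and a companion certificate: partner `W'` with twist model `C' • V'^{(p*)} = W'`, `V'` good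
at `p`, a `Γ_ℚ`-isomorphism `W'[p] ⥲ W[p]`, places `S`, a witness `P ∈ W'(ℚ) ∖ pW'(ℚ)` with local options
(a)/(i)/(vi)]. The bracket is NOT a theorem (it is a per-pair search with finitely many successes in any
range); the statement records exactly what a per-pair certificate buys toward the crux. Nothing booked.
[cite: MazurRubin2015SelmerCompanions, Thm. 3.1 and §6 Case 5] [cite: CremonaMazur2000, §3 and Table 1]
[cite: SilvermanAEC2009, Thm. X.4.14] -/
theorem gordTwoRankZeroOffCaseOne_of_companionWitnesses
    (hCT : exists_casselsTate_pairing (K := ℚ)) (hGZK : rank_eq_analyticRank_of_analyticRank_le_one)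
    (hMRt : selmerLocalKer_iff_of_twist_of_goodReduction_above)
    (hrows : ∀ (W : WeierstrassCurve ℚ) [W.IsElliptic] [W.IsGloballyMinimal] (p : ℕ) [Fact p.Prime],
      W.analyticRank = 0 → N10.CellGordTwo W p → ¬ HasCaseOneMember W p →
      MissingLowerBoundAt W p ∨
      (Irr W p ∧ ∃ (q : ℚ), shaAn W = (q : ℂ) ∧ padicValRat p q ≤ 2 ∧
        ∃ (W' : WeierstrassCurve ℚ) (_ : W'.IsElliptic) (V' : WeierstrassCurve ℚ) (_ : V'.IsElliptic)
          (C' : VariableChange ℚ) (_ : C' • V'.quadraticTwist ((-1 : ℚ) ^ (p / 2) * p) = W')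
          (_ : V'.HasGoodReductionAtPrime p)
          (θ : geomTorsion W' (p : ℤ) ≃+ geomTorsion W (p : ℤ))
          (_ : ∀ (σ : absoluteGaloisGroup ℚ) (P : geomTorsion W' (p : ℤ)), θ (σ • P) = σ • θ P)
          (S : Finset (HeightOneSpectrum (𝓞 ℚ)))
          (_ : ∀ w : HeightOneSpectrum (𝓞 ℚ), w ∉ S →
            W.HasGoodReductionAt w ∧ W'.HasGoodReductionAt w ∧ (p : 𝓞 ℚ) ∉ w.asIdeal)
          (P : W'.toAffine.Point)
          (_ : P ∉ (zsmulAddGroupHom (p : ℤ) : W'.toAffine.Point →+ W'.toAffine.Point).range),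
          ∀ w ∈ S,
            (∃ Q : (W'.baseChange (w.adicCompletion ℚ)).toAffine.Point,
              p • Q = WeierstrassCurve.Affine.Point.baseChange (W' := W') ℚ (w.adicCompletion ℚ) P) ∨
            ((p : 𝓞 ℚ) ∉ w.asIdeal ∧ Nat.card (nsmulAddMonoidHom p :
                (W'.baseChange (w.adicCompletion ℚ)).toAffine.Point →+ _).ker = 1) ∨
            ((p : 𝓞 ℚ) ∈ w.asIdeal))) :
    GordTwoRankZeroOffCaseOne := by
  intro W _ _ p _ hr hc hC1
  rcases hrows W p hr hc hC1 with h | ⟨hirr, q, hq, hv, W', _, V', _, C', hWV', hV', θ, hθ, S, hS, P,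
    hP, hplaces⟩
  · exact h
  · exact missingLowerBoundAt_rankZero_irr_of_companionWitness hCT hGZK hMRt hc hirr hr hq hv W' V' C'
      hWV' hV' θ hθ S hS P hP hplaces

end Crux

end Summit.BirchSwinnertonDyer.BirchSwinnertonDyer.Theorems.AdditiveBranchIMCGordTwoRankZeroCompanion

end
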